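/-
Copyright (c) 2026 the pub-hodgecm-mathlib formalisation cell (harness21).  Prover seat hodgecm-mathlib-K2Liu-p14 (g3), Track B «K2-LIT»,
#184♮ = hLiu418 = `stmt-HodgeConjecture-24832`; Road I v3, S5-F3 lineage ∕ I4-conv (F′-fact), FILE E part 2: the ASSEMBLY into the ★ #31s factorizable shape.
-/
import Summits.HodgeConjecture.HodgeConjecture.Theorems.K2LiuKlingenInnerSectionLocalDefs   -- ★ FILE B: `innerSectionLoc`, `psiLoc`, `evalPlace_finPart_eq_psiLoc`
import Literature.NumberTheory.K2Lit.LocalDoublingSiegel                                    -- ★ D7c: `LambdaLoc`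
import Mathlib.Topology.Algebra.InfiniteSum.Basic
import HarnessLib

/-!
# Crux `HLiu418`, I4-conv (F′-fact), FILE E part 2 — `K2LiuKlingenInnerSectionFactorizable`: THE ASSEMBLY —
# `F′_h(g₂) = I_{T′} · (∏'_{v∉T′} c_v) · ∏ᶠ_{v∉T′} Λ^{line}_{s−½,v}((Ψ_S g₂)_v)` from the place-by-place Euler product, the local identities and the line bridge

Cell `hodgecm-mathlib`, crux item hLiu418 = `stmt-HodgeConjecture-24832`; squad K2 ∕ K2Liu; LEAD F0P6-plan (g14) BATCH #36 (E = mine); prover K2Liu-p14 (g3).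
THEOREMS ONLY (no `def`, no instance, no notation, no named-fact hypothesis, no `sorry`); lane `--supports stmt-HodgeConjecture-24832 --as helper` (count-neutral).

THE ORGAN (census `K2/K2Liu-p14/g3/CENSUS-I4conv-FprimeFact.K2Liu-p14-g3.md`): ★ F8∕F5-q's inner section `F′_h(g₂) = ∫_{Y(𝔸)×𝔸_L} f_s(Ψ(ξ)·Ψ(n_Q(y,0,t))·(Ψ(m_Q(1,j₂⁻¹g₂))·h)) d(μ_Y ⊗ μ_T)`
of term 2 of the Klingen constant term is Euler-factorised in three moves, each ★ or 📤 by name: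
(1) THE EULER PRODUCT over the places `v ∉ T′` of `L⁺` — ★ D `K2LiuKlingenInnerSectionEuler` ∕ ★ D part 2 `…EulerOff` (finite exceptional set) at ★ D0's pin
`K2LiuKlingenFibreHaarPinned` (F0P2-p09) through ★ `K2LiuKlingenFibreLocalCoordinates.exists_localCoord` (L2)(L4) and the natural-coordinate SHAPE ★∕📤 E part 1
`integrand_eq_mul_finprod` ∕ `local_factor_eq_one`: `F′_h(g₂) = I · ∏'_{v∉T′} J_v((g₂)_v)`, `J_v = ★ B innerSectionLoc v (νY v) (νT v) (psiLoc Ψ v) (Λ_{s,v}) h_v` — taken here BY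
VALUE as `hEuler` (its discharge is the natural-coordinate corollary of ★ D0∘D, E-D0);
(2) THE LOCAL IDENTITIES `J_v(x) = c_v · Λ^{line}_{s−½,v}(κ_v x)` — ★ C `K2LiuKlingenInnerSectionSpherical.apply_eq_apply_one_mul_lambdaLoc_apply` (F0P2-p10) fed by ★ `hK`
`K2LiuKlingenInnerSectionLocalInvariance` and the `hlaw` payers (F0P2-p09∕p10) — BY VALUE as `hJ`, with `Multipliable c` (`hc`) and the finite multiplicative support of
`v ↦ Λ^{line}_{s−½,v}(κ_v (g₂)_v)` (`hΛ`: `(g₂)_v ∈ U(J₂)(𝒪_v)` for almost all `v`, ★ `eventually_evalPlace_mem_localInt`, `κ_v` preserves integrality at good `v`, ★ C part 1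
`symm_apply_mem_localInt_iff`, `Λ = 1` on `K`);
(3) THE LINE BRIDGE `κ_v = Ψ_{S,v} = psiLoc Ψ_S v`: `Λ^{line}(κ_v (g₂)_v) = Λ^{line}((Ψ_S g₂)_v)` (★ B `evalPlace_finPart_eq_psiLoc`).
* §1 `tprod_mul_eq_tprod_mul_finprod` — `∏' v, c_v · b_v = (∏' v, c_v) · ∏ᶠ v, b_v` for `Multipliable c` and `b` of finite multiplicative support (Mathlib `Multipliable.tprod_mul`,
  `tprod_eq_finprod`).
* §2 **`innerSection_eq_mul_tprod_mul_finprod`** — (1)+(2): `F′_h(g₂) = I · (∏'_{v∉T′} c_v) · ∏ᶠ_{v∉T′} Λ^{line}_{s−½,v}(κ_v (g₂)_v)`.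
* §3 **`innerSection_eq_mul_tprod_mul_finprod_psiLoc`** — (3) at `κ_v := psiLoc Ψ_S v` for a pinned global bridge `Ψ_S` (★ carrier `K2LiuKlingenTermTwoTransport`'s
  `adelicUnitaryGroupCongr L S _ _ hc`, pin ★ `coe_adelicUnitaryGroupCongr`): `F′_h(g₂) = I · (∏' c_v) · ∏ᶠ_{v∉T′} Λ^{line}_{s−½,v}((Ψ_S g₂)_v)` — the away-product of ★ #31s
  `IsFactorizableOff T′ χ · ·` at `x = Ψ_S g₂`, BYTE FOR BYTE; so the LINE family `g s′ x := gT′ s′ (x_∞, x_{T′}) · ∏ᶠ_{v∉T′} Λ^{line}_{s′,v}(x_v)` (★ #31s-factorizable by `rfl`) agrees with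
  `F′_{h,f_{s′+½}} ∘ Ψ_S⁻¹` wherever `gT′ s′ ((Ψ_S g₂)_∞, (Ψ_S g₂)_{T′}) = I · ∏' c_v` — the census's architecture («write `g`, prove the Euler identity on `1 < re s`»).
[CasselsFrohlichANT1967, Ch. XV (Tate) §3.3 Thm. 3.3.1], [Liu2011, §2B p. 862], [Tan1999, §1–§2], [MoeglinWaldspurger1995, II.1.7], [KudlaRallis1994, §1].
HONEST LABEL.  Count-neutral helper, closes no socket: `HC_CM` is proved only modulo the 7 printed citations (2 remaining named inputs: hLiu418 =
`stmt-HodgeConjecture-24832`, h413 = `stmt-HodgeConjecture-24833`) until rung 0 closes.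
-/

set_option autoImplicit false
set_option linter.dupNamespace false -- the mandated namespace repeats `HodgeConjecture.HodgeConjecture`

noncomputable section

open scoped Matrix
open NumberField IsDedekindDomain MeasureTheory

namespace Summit.HodgeConjecture.HodgeConjecture.Cruxes.HLiu418.K2LiuKlingenInnerSectionFactorizable

open Literature.NumberTheory.Automorphic Literature.NumberTheory.Automorphic.UnitaryGroup
open Literature.NumberTheory.GelbartRogawski1991 Literature.NumberTheory.GelbartRogawski1991.GRConstruction
open Literature.NumberTheory.GaloisRepresentations
open Literature.NumberTheory.K2Lit.SiegelDoubled
open Summit.HodgeConjecture.HodgeConjecture.Cruxes.HLiu418.K2LiuKlingenParabolicDefs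
open Summit.HodgeConjecture.HodgeConjecture.Cruxes.HLiu418.K2LiuKlingenUnipotentAdelicDefs
open Summit.HodgeConjecture.HodgeConjecture.Cruxes.HLiu418.K2LiuSiegelDoubledLeviMatrix (conjAdele_conjAdele')
open Summit.HodgeConjecture.HodgeConjecture.Cruxes.HLiu418.K2LiuKlingenInnerSectionLocalDefs

/-! ## §1 Splitting an Euler product off a finitely supported factor -/

/-- **`∏' i, c_i · b_i = (∏' i, c_i) · ∏ᶠ i, b_i`** for `c` multipliable and `b` of finite multiplicative support (Mathlib `Multipliable.tprod_mul`, `tprod_eq_finprod`).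
[cite: CasselsFrohlichANT1967, Ch. XV (Tate) §3.3] -/
theorem tprod_mul_eq_tprod_mul_finprod {ι : Type*} (c b : ι → ℂ) (hc : Multipliable c) (hb : (Function.mulSupport b).Finite) :
    ∏' i, c i * b i = (∏' i, c i) * ∏ᶠ i, b i := by
  rw [hc.tprod_mul (multipliable_of_hasFiniteMulSupport hb), tprod_eq_finprod hb]

/-! ## §2 The assembly: Euler product + local identities -/

section Assembly

variable (L : Type) [Field L] [NumberField L] [IsCMField L]
variable {N M : ℕ} {e : Fin N × Fin M ≃ Fin 2}
  {dV : Fin N → L} {hdV : ∀ i, IsCMField.complexConj L (dV i) = dV i}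
  {dW : Fin M → L} {hdW : ∀ i, IsCMField.complexConj L (dW i) = dW i}

/-- **THE ASSEMBLY.**  Let `F′` be the inner section of term 2 at `g₂` (any complex number standing for ★ F8's `∫ … d(μ_Y ⊗ μ_T)`), Euler-factorised over the places
`v ∉ T′` as `F′ = I · ∏'_v J_v((g₂)_v)` with `J_v = innerSectionLoc v (νY v) (νT v) (psiLoc Ψ v) (Λ_{s,v}) h_v` (`hEuler`: ★ D∕D part 2 at ★ D0's pin through ★ E part 1's
shape), and let every `J_v` be `c_v · Λ^{line}_{σ,v} ∘ κ_v` (`hJ`: ★ C fed by ★ `hK` and the `hlaw` payers; `σ = s − ½`) with `Multipliable c` and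
`v ↦ Λ^{line}_{σ,v}(κ_v (g₂)_v)` finitely supported away from `1`.  THEN `F′ = I · (∏'_v c_v) · ∏ᶠ_v Λ^{line}_{σ,v}(κ_v (g₂)_v)`.
[cite: CasselsFrohlichANT1967, Ch. XV (Tate) §3.3 Thm. 3.3.1] [cite: Liu2011, §2B p. 862] [cite: MoeglinWaldspurger1995, II.1.7] -/
theorem innerSection_eq_mul_tprod_mul_finprod (T' : Finset (HeightOneSpectrum (𝓞 (Fp L))))
    [∀ v : HeightOneSpectrum (𝓞 (Fp L)), MeasurableSpace ↥(skewLoc L v)] [∀ v : HeightOneSpectrum (𝓞 (Fp L)), MeasurableSpace (LocalRing L v)]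
    (νY : ∀ v : HeightOneSpectrum (𝓞 (Fp L)), Measure ↥(skewLoc L v)) (νT : ∀ v : HeightOneSpectrum (𝓞 (Fp L)), Measure (LocalRing L v))
    (Ψv : ∀ v : HeightOneSpectrum (𝓞 (Fp L)), UnitaryGroup.localPi L (IsCMField.complexConj L) 4 ((StdForm.antidiagonal 4).over L) v →*
      UnitaryGroup.localPi L (IsCMField.complexConj L) (2 + 2) (hermD L e dV hdV dW hdW) v)
    (χ : HeckeCharacter L) (s σ : ℂ)
    (hv : ∀ v : HeightOneSpectrum (𝓞 (Fp L)), UnitaryGroup.localPi L (IsCMField.complexConj L) (2 + 2) (hermD L e dV hdV dW hdW) v)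
    (gv : ∀ v : HeightOneSpectrum (𝓞 (Fp L)), UnitaryGroup.localPi L (IsCMField.complexConj L) 2 ((StdForm.antidiagonal 2).over L) v)
    (F' I : ℂ)
    (hEuler : F' = I * ∏' v : {v : HeightOneSpectrum (𝓞 (Fp L)) // v ∉ T'},
      innerSectionLoc L v.1 (νY v.1) (νT v.1) (Ψv v.1) (LambdaLoc L e dV hdV dW hdW v.1 χ s) (hv v.1) (gv v.1))
    (κ : ∀ v : HeightOneSpectrum (𝓞 (Fp L)), UnitaryGroup.localPi L (IsCMField.complexConj L) 2 ((StdForm.antidiagonal 2).over L) v →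
      UnitaryGroup.localPi L (IsCMField.complexConj L) (1 + 1)
        (hermD L (Equiv.prodUnique (Fin 1) (Fin 1)) (fun _ => (1 : L)) (fun _ => map_one _) (fun _ => (1 : L)) (fun _ => map_one _)) v)
    (c : {v : HeightOneSpectrum (𝓞 (Fp L)) // v ∉ T'} → ℂ) (hc : Multipliable c)
    (hJ : ∀ (v : {v : HeightOneSpectrum (𝓞 (Fp L)) // v ∉ T'}) (x : UnitaryGroup.localPi L (IsCMField.complexConj L) 2 ((StdForm.antidiagonal 2).over L) v.1),
      innerSectionLoc L v.1 (νY v.1) (νT v.1) (Ψv v.1) (LambdaLoc L e dV hdV dW hdW v.1 χ s) (hv v.1) x =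
        c v * LambdaLoc L (Equiv.prodUnique (Fin 1) (Fin 1)) (fun _ => (1 : L)) (fun _ => map_one _) (fun _ => (1 : L)) (fun _ => map_one _) v.1 χ σ (κ v.1 x))
    (hΛ : (Function.mulSupport fun v : {v : HeightOneSpectrum (𝓞 (Fp L)) // v ∉ T'} =>
      LambdaLoc L (Equiv.prodUnique (Fin 1) (Fin 1)) (fun _ => (1 : L)) (fun _ => map_one _) (fun _ => (1 : L)) (fun _ => map_one _) v.1 χ σ (κ v.1 (gv v.1))).Finite) :
    F' = I * (∏' v : {v : HeightOneSpectrum (𝓞 (Fp L)) // v ∉ T'}, c v) *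
      ∏ᶠ v : {v : HeightOneSpectrum (𝓞 (Fp L)) // v ∉ T'},
        LambdaLoc L (Equiv.prodUnique (Fin 1) (Fin 1)) (fun _ => (1 : L)) (fun _ => map_one _) (fun _ => (1 : L)) (fun _ => map_one _) v.1 χ σ (κ v.1 (gv v.1)) := by
  rw [hEuler, mul_assoc, ← tprod_mul_eq_tprod_mul_finprod _ _ hc hΛ]
  exact congrArg (fun z => I * z) (tprod_congr fun v => hJ v (gv v.1))

end Assembly

/-! ## §3 The assembly at the line bridge of record `κ_v = Ψ_{S,v} = psiLoc Ψ_S v` -/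

section Bridge

variable (L : Type) [Field L] [NumberField L] [IsCMField L]
variable {N M : ℕ} {e : Fin N × Fin M ≃ Fin 2}
  {dV : Fin N → L} {hdV : ∀ i, IsCMField.complexConj L (dV i) = dV i}
  {dW : Fin M → L} {hdW : ∀ i, IsCMField.complexConj L (dW i) = dW i}

set_option maxHeartbeats 1600000 in -- MEASURED: `Fin 2` vs `Fin (1 + 1)` spellings of the doubled line (`localPi … 2 (hermD …)` of `psiLoc` vs `… (1 + 1) …` of `LambdaLoc`), as ★ C
/-- **THE ASSEMBLY AT THE GLOBAL LINE BRIDGE.**  For a pinned global bridge `Ψ_S : U(J₂)(𝔸) →* H₁(𝔸)` (conjugation by an adelic matrix `SB`: `hΨS` — ★ carrier's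
`adelicUnitaryGroupCongr L S _ _ hc` with ★ `coe_adelicUnitaryGroupCongr`) and `κ_v := psiLoc Ψ_S v`: `F′ = I · (∏'_v c_v) · ∏ᶠ_{v∉T′} Λ^{line}_{σ,v}((Ψ_S g₂)_v)` —
the away-product of ★ #31s `IsFactorizableOff T′ χ · ·` on the doubled LINE at the point `Ψ_S g₂` (★ B `evalPlace_finPart_eq_psiLoc`).
[cite: Liu2011, §2B p. 862] [cite: Tan1999, §1] [cite: MoeglinWaldspurger1995, II.1.7] -/
theorem innerSection_eq_mul_tprod_mul_finprod_psiLoc (T' : Finset (HeightOneSpectrum (𝓞 (Fp L))))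
    [∀ v : HeightOneSpectrum (𝓞 (Fp L)), MeasurableSpace ↥(skewLoc L v)] [∀ v : HeightOneSpectrum (𝓞 (Fp L)), MeasurableSpace (LocalRing L v)]
    (νY : ∀ v : HeightOneSpectrum (𝓞 (Fp L)), Measure ↥(skewLoc L v)) (νT : ∀ v : HeightOneSpectrum (𝓞 (Fp L)), Measure (LocalRing L v))
    (Ψv : ∀ v : HeightOneSpectrum (𝓞 (Fp L)), UnitaryGroup.localPi L (IsCMField.complexConj L) 4 ((StdForm.antidiagonal 4).over L) v →*
      UnitaryGroup.localPi L (IsCMField.complexConj L) (2 + 2) (hermD L e dV hdV dW hdW) v)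
    (χ : HeckeCharacter L) (s σ : ℂ)
    (hv : ∀ v : HeightOneSpectrum (𝓞 (Fp L)), UnitaryGroup.localPi L (IsCMField.complexConj L) (2 + 2) (hermD L e dV hdV dW hdW) v)
    (g₂ : (quasiSplit (Fp L) L (IsCMField.complexConj L) 2).Adelic)
    (F' I : ℂ)
    (hEuler : F' = I * ∏' v : {v : HeightOneSpectrum (𝓞 (Fp L)) // v ∉ T'},
      innerSectionLoc L v.1 (νY v.1) (νT v.1) (Ψv v.1) (LambdaLoc L e dV hdV dW hdW v.1 χ s) (hv v.1)
        (UnitaryGroup.evalPlace (Fp L) L (IsCMField.complexConj L) 2 ((StdForm.antidiagonal 2).over L) v.1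
          (UnitaryGroup.finPart (Fp L) L (IsCMField.complexConj L) 2 ((StdForm.antidiagonal 2).over L) g₂)))
    (ΨS : (adelicGroupData (Fp L) L (IsCMField.complexConj L) 2 ((StdForm.antidiagonal 2).over L)).Adelic →*
      (adelicGroupData (Fp L) L (IsCMField.complexConj L) 2
        (hermD L (Equiv.prodUnique (Fin 1) (Fin 1)) (fun _ => (1 : L)) (fun _ => map_one _) (fun _ => (1 : L)) (fun _ => map_one _))).Adelic)
    (SB : GL (Fin 2) (AdeleRing (𝓞 L) L))
    (hΨS : ∀ g : (adelicGroupData (Fp L) L (IsCMField.complexConj L) 2 ((StdForm.antidiagonal 2).over L)).Adelic,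
      (((ΨS g).1 : GL (Fin 2) (AdeleRing (𝓞 L) L)) : Matrix (Fin 2) (Fin 2) (AdeleRing (𝓞 L) L)) =
        (SB : Matrix (Fin 2) (Fin 2) (AdeleRing (𝓞 L) L)) *
          ((adelicVal (Fp L) L (IsCMField.complexConj L) 2 ((StdForm.antidiagonal 2).over L) g : GL (Fin 2) (AdeleRing (𝓞 L) L)) : Matrix (Fin 2) (Fin 2) (AdeleRing (𝓞 L) L)) *
          ((SB⁻¹ : GL (Fin 2) (AdeleRing (𝓞 L) L)) : Matrix (Fin 2) (Fin 2) (AdeleRing (𝓞 L) L)))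
    (c : {v : HeightOneSpectrum (𝓞 (Fp L)) // v ∉ T'} → ℂ) (hc : Multipliable c)
    (hJ : ∀ (v : {v : HeightOneSpectrum (𝓞 (Fp L)) // v ∉ T'}) (x : UnitaryGroup.localPi L (IsCMField.complexConj L) 2 ((StdForm.antidiagonal 2).over L) v.1),
      innerSectionLoc L v.1 (νY v.1) (νT v.1) (Ψv v.1) (LambdaLoc L e dV hdV dW hdW v.1 χ s) (hv v.1) x =
        c v * LambdaLoc L (Equiv.prodUnique (Fin 1) (Fin 1)) (fun _ => (1 : L)) (fun _ => map_one _) (fun _ => (1 : L)) (fun _ => map_one _) v.1 χ σ (psiLoc L ΨS v.1 x))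
    (hΛ : (Function.mulSupport fun v : {v : HeightOneSpectrum (𝓞 (Fp L)) // v ∉ T'} =>
      LambdaLoc L (Equiv.prodUnique (Fin 1) (Fin 1)) (fun _ => (1 : L)) (fun _ => map_one _) (fun _ => (1 : L)) (fun _ => map_one _) v.1 χ σ
        (UnitaryGroup.evalPlace (Fp L) L (IsCMField.complexConj L) 2 _ v.1 (UnitaryGroup.finPart (Fp L) L (IsCMField.complexConj L) 2 _ (ΨS g₂)))).Finite) :
    F' = I * (∏' v : {v : HeightOneSpectrum (𝓞 (Fp L)) // v ∉ T'}, c v) *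
      ∏ᶠ v : {v : HeightOneSpectrum (𝓞 (Fp L)) // v ∉ T'},
        LambdaLoc L (Equiv.prodUnique (Fin 1) (Fin 1)) (fun _ => (1 : L)) (fun _ => map_one _) (fun _ => (1 : L)) (fun _ => map_one _) v.1 χ σ
          (UnitaryGroup.evalPlace (Fp L) L (IsCMField.complexConj L) 2 _ v.1 (UnitaryGroup.finPart (Fp L) L (IsCMField.complexConj L) 2 _ (ΨS g₂))) := by
  have hκ : ∀ v : {v : HeightOneSpectrum (𝓞 (Fp L)) // v ∉ T'},
      psiLoc L ΨS v.1 (UnitaryGroup.evalPlace (Fp L) L (IsCMField.complexConj L) 2 ((StdForm.antidiagonal 2).over L) v.1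
          (UnitaryGroup.finPart (Fp L) L (IsCMField.complexConj L) 2 ((StdForm.antidiagonal 2).over L) g₂)) =
        UnitaryGroup.evalPlace (Fp L) L (IsCMField.complexConj L) 2 _ v.1 (UnitaryGroup.finPart (Fp L) L (IsCMField.complexConj L) 2 _ (ΨS g₂)) :=
    fun v => (evalPlace_finPart_eq_psiLoc L ΨS SB hΨS v.1 g₂).symm
  have hΛ' : (Function.mulSupport fun v : {v : HeightOneSpectrum (𝓞 (Fp L)) // v ∉ T'} =>
      LambdaLoc L (Equiv.prodUnique (Fin 1) (Fin 1)) (fun _ => (1 : L)) (fun _ => map_one _) (fun _ => (1 : L)) (fun _ => map_one _) v.1 χ σ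
        (psiLoc L ΨS v.1 (UnitaryGroup.evalPlace (Fp L) L (IsCMField.complexConj L) 2 ((StdForm.antidiagonal 2).over L) v.1
          (UnitaryGroup.finPart (Fp L) L (IsCMField.complexConj L) 2 ((StdForm.antidiagonal 2).over L) g₂)))).Finite := by
    simp_rw [hκ]; exact hΛ
  have h := innerSection_eq_mul_tprod_mul_finprod L T' νY νT Ψv χ s σ hv
    (fun v => UnitaryGroup.evalPlace (Fp L) L (IsCMField.complexConj L) 2 ((StdForm.antidiagonal 2).over L) v
      (UnitaryGroup.finPart (Fp L) L (IsCMField.complexConj L) 2 ((StdForm.antidiagonal 2).over L) g₂)) F' I hEuler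
    (fun v => psiLoc L ΨS v) c hc hJ hΛ'
  simp_rw [hκ] at h
  exact h

end Bridge

end Summit.HodgeConjecture.HodgeConjecture.Cruxes.HLiu418.K2LiuKlingenInnerSectionFactorizable

end
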